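import Summits.BirchSwinnertonDyer.BirchSwinnertonDyer.Theorems.KatoDescentPotSupersingularWildConjAResidueCartanRowsNnIw01
import Summits.BirchSwinnertonDyer.BirchSwinnertonDyer.Theorems.KatoDescentTamePotSupersingularCartanMuRoadQuadraticUpperDoors
import HarnessLib

/-!
# Route `KatoDescentPotSupersingular` (rung K9, sub-rung B5 O6 wild `p = 3`, cell `bsd-potss`) — COURTESY by seat `bsd-potss-k8t-c4` g23 for the k9-c4 lane:
# the `p = 3` Conj-A residue Cartan rows of `KatoDescentPotSupersingularWildConjAResidueCartanRowsNoGrowthNnIw01` RE-RECORDED with NO NAMED FACT for statement (A) — Ferrero–Washington REMOVED — and U₀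
# `MissingUpperBoundAt E 3` modulo `hKatoA hGZK hmod` ONLY (`--supports stmt-BirchSwinnertonDyer-19197 --as helper`; closes nothing)

HONEST FRAMING. Route-free THEOREMS ONLY (no definition, no named fact, no `sorry`); PER ROW — NOT a class theorem; nothing is booked; items 19189 /
19197 / 19942 stay OPEN at class level (class-wide open inputs unchanged: the zeta crux 24327 and the residual 19200); (A), Conjecture A and BSD are
proved for NO curve as a class. WHAT CHANGED (g23): the g22 courtesy records `…_noGrowth` displayed ONE named fact for (A), Ferrero–Washington (`hFW`).
By the character count of `Literature/…/IwasawaTheory/ClassicalMuVanishesCartanQuadraticDescent` + `…CartanImageThreeQuadratic` (on `Gal(ℚ(E[3])/ℚ) ≅ SD₁₆`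
every irreducible character occurs in `Ind_⟨c⟩ 1 = ℚ(P)` except the two linear ones with `χ(c) = −1`, whose fields are the IMAGINARY QUADRATIC subfields)
`hFW` is replaced by the displayed datum `hqrk`: «for every quadratic `K ⊆ ℚ(E[3])` NOT fixed by the complex conjugation `c` and every cyclotomic
`ℤ₃`-extension of `K`, `rank₃ Cl(K₁) = rank₃ Cl(K₀)`» — Fukuda 1994 Thm. 1 (2), a tree theorem. NUMERICS (kit j326955: `nfsubfields` of the splitting
field of `ψ₃`; `bnfinit` + `bnfcertify` = 1 at degrees 2 and 6, GRH-free): on every row below `ℚ(E[3])` has exactly three quadratic subfields `ℚ(√−3)`,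
`ℚ(√D)` (`D < 0`), `ℚ(√(3·|D|))` resp. `ℚ(√(|D|/3))` (real); the two imaginary ones satisfy `hqrk`: `ℚ(√−3)`: `h = 1`, `K₁ = ℚ(ζ₉)` (`x^6 - x^3 + 1`),
`h = 1`, `rank₃: 0 = 0`; `ℚ(√D)` as recorded per row. The `ℚ(P)` datum (`hμ` resp. `hh`/`hv`), Cremona's `r_an = 0` and the kernel certificates
(`irr_…`, `hasModPImageEqNonsplitCartanNormalizer_…`, `classO6_…`) are those of the source records, REUSED. Doors: `CartanMuRoadQuadraticDoors` /
`…QuadraticUpperDoors` (k8t-c4 g23).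
[cite: Fukuda1994, Thm. 1, p. 264] [cite: CoatesSujatha2005, Thm. 3.4 (§3)] [cite: Kato2004Asterisque, Thm. 14.5 (3) (p. 236)] [cite: Serre1972, §2.2, §5.2 (iv)]
[cite: Greenberg2001IwasawaPastPresent, Prop. (2.1) (p. 339)] [cite: Washington1997, §13.1, §13.3 Prop. 13.23] [cite: Cremona2006, Table 1]
-/

set_option autoImplicit false
set_option linter.dupNamespace false

noncomputable section

open scoped Classical NumberField
open Polynomial WeierstrassCurve NumberField Field IntermediateField
  Literature.NumberTheory.EllipticCurves Literature.NumberTheory.EllipticCurves.Rank1Residual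
  Literature.NumberTheory.EllipticCurves.Rank1Residual.Typed
  Literature.NumberTheory.GaloisRepresentations Literature.NumberTheory.SerreUniformity Literature.NumberTheory.IwasawaTheory
  Summit.BirchSwinnertonDyer.Rank1Residual Summit.BirchSwinnertonDyer.Rank1Residual.Additive
  Summit.BirchSwinnertonDyer.BirchSwinnertonDyer.Theorems
  Summit.BirchSwinnertonDyer.BirchSwinnertonDyer.Theorems.TameUpperUnitTwistRecords

namespace Summit.BirchSwinnertonDyer.BirchSwinnertonDyer.Theorems.WildUpperUnitTwistRecords

/-- **(A) at `(19008bu1, 3)` from `3 ∤ h(ℚ(P)) and one prime of ℚ(P) above 3 (Iwasawa 1956)` and `rank₃ Cl(K₁) = rank₃ Cl(K₀)` on the two imaginary quadratic subfields — NO NAMED FACT** (Coates–Sujatha 3.4,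
Iwasawa 1956, Fukuda Thm. 1 PROVED; Ferrero–Washington REMOVED; door `CartanMuRoadQuadraticDoors`; kernel certificates `irr_g19008bu1_3`, `hasModPImageEqNonsplitCartanNormalizer_g19008bu1_3` reused).
DISPLAYED: quadratic subfields of `ℚ(E[3])` (kit j326955): `ℚ(√−3)`, `ℚ(√-4)`, `ℚ(√12)` (real); the imaginary pair certified for `hqrk`: `ℚ(√-3)`: `h = 1` (`Cl ≅ []`), layer 1 `K₁ = ℚ(√-3)·ℚ(ζ₉)⁺` = `x^6 - x^3 + 1`, `h(K₁) = 1` (`Cl ≅ []`), `rank₃`: `0 = 0` — bnfcertify 1/1; `ℚ(√-4)`: `h = 1` (`Cl ≅ []`), layer 1 `K₁ = ℚ(√-4)·ℚ(ζ₉)⁺` = `x^6 + 6*x^4 + 9*x^2 + 1`, `h(K₁) = 1` (`Cl ≅ []`), `rank₃`: `0 = 0` — bnfcertify 1/1. Per row; (A) is now a consequence of displayed integers ALONE.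
[cite: Fukuda1994, Thm. 1, p. 264] [cite: CoatesSujatha2005, Thm. 3.4 (§3)] [cite: Washington1997, §13.1, §13.3 Prop. 13.23] [cite: Cremona2006, Table 1 (Cremona label 19008bu1)] -/
theorem conjA_g19008bu1_3_iw_quad
    {W : WeierstrassCurve ℚ} [W.IsElliptic] (hWeq : W = (⟨0, 0, 0, (-999), (-12312)⟩ : WeierstrassCurve ℚ))
    {c : absoluteGaloisGroup ℚ} (hc : IsComplexConjugation (Rat.castHom ℝ) c)
    (hh : haveI : NumberField ↥(W.divisionField 3) := NumberField.mk
      ¬ 3 ∣ NumberField.classNumber ↥(fixedField (Subgroup.zpowers (absRestrictNormalHom (W.divisionField 3) c))))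
    (hv : haveI : NumberField ↥(W.divisionField 3) := NumberField.mk
      ∃! v : IsDedekindDomain.HeightOneSpectrum (𝓞 ↥(fixedField (Subgroup.zpowers (absRestrictNormalHom (W.divisionField 3) c)))),
        ((3 : ℕ) : 𝓞 ↥(fixedField (Subgroup.zpowers (absRestrictNormalHom (W.divisionField 3) c)))) ∈ v.asIdeal)
    (hqrk : haveI : NumberField ↥(W.divisionField 3) := NumberField.mk
      ∀ K : IntermediateField ℚ ↥(W.divisionField 3), Module.finrank ℚ ↥K = 2 →
        ¬ K ≤ fixedField (Subgroup.zpowers (absRestrictNormalHom (W.divisionField 3) c)) →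
        ∀ κE : ZpExtension ↥K 3, κE.IsCyclotomic → classGroupPRank κE (0 + 1) = classGroupPRank κE 0)
    (κ : ZpExtension ℚ 3) (hκ : κ.IsCyclotomic) :
    ∃ (γ : absoluteGaloisGroup ℚ) (Df : W.FineSelmerDualData κ γ),
      Module.Finite ℤ_[3] (RestrictScalars ℤ_[3] (IwasawaAlgebra 3) Df.X) := by
  subst hWeq
  exact CartanMuRoadQuadraticDoors.conjA_three_of_hasModPImageEqNonsplitCartanNormalizer_of_realClassNumber_of_quadRankSuccEqAt _ irr_g19008bu1_3
    hasModPImageEqNonsplitCartanNormalizer_g19008bu1_3 hc hh hv 0 hqrk κ hκ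

/-- **RECORD — UPPER half `ord₃ #Ш(E) ≤ ord₃ #Ш(E)_an` for `E = 19008bu1` at `p = 3` (O6 wild) from `3 ∤ h(ℚ(P)) and one prime of ℚ(P) above 3 (Iwasawa 1956)` and the imaginary-quadratic rank datum `hqrk`, modulo `hKatoA hGZK hmod` ONLY**
(Ferrero–Washington REMOVED; kernel certificates `classO6_…`, `irr_…`, `hasModPImageEqNonsplitCartanNormalizer_…` reused; Cremona's `r_an = 0` displayed).
DISPLAYED: quadratic subfields of `ℚ(E[3])` (kit j326955): `ℚ(√−3)`, `ℚ(√-4)`, `ℚ(√12)` (real); the imaginary pair certified for `hqrk`: `ℚ(√-3)`: `h = 1` (`Cl ≅ []`), layer 1 `K₁ = ℚ(√-3)·ℚ(ζ₉)⁺` = `x^6 - x^3 + 1`, `h(K₁) = 1` (`Cl ≅ []`), `rank₃`: `0 = 0` — bnfcertify 1/1; `ℚ(√-4)`: `h = 1` (`Cl ≅ []`), layer 1 `K₁ = ℚ(√-4)·ℚ(ζ₉)⁺` = `x^6 + 6*x^4 + 9*x^2 + 1`, `h(K₁) = 1` (`Cl ≅ []`), `rank₃`: `0 = 0` — bnfcertify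 1/1. Per row; nothing booked; BSD is not proved by this. [cite: Kato2004Asterisque, Thm. 14.5 (3) (p. 236)] [cite: Fukuda1994, Thm. 1, p. 264]
[cite: CoatesSujatha2005, Thm. 3.4 (§3)] [cite: Cremona2006, Table 1 (Cremona label 19008bu1)] -/
theorem missingUpperBoundAt_g19008bu1_3_iw_quad
    (hKatoA : Kato2004.rankZero_padicValNat_sha_add_padicValNat_tamagawa_le_of_additive_potGood_of_irreducible_of_fineSelmerDual_fg)
    (hGZK : rank_eq_analyticRank_of_analyticRank_le_one) (hmod : hasEntireLFunction_rat)
    {W : WeierstrassCurve ℚ} [W.IsElliptic] [W.IsGloballyMinimal] (hWeq : W = (⟨0, 0, 0, (-999), (-12312)⟩ : WeierstrassCurve ℚ)) (hr : W.analyticRank = 0)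
    {c : absoluteGaloisGroup ℚ} (hc : IsComplexConjugation (Rat.castHom ℝ) c)
    (hh : haveI : NumberField ↥(W.divisionField 3) := NumberField.mk
      ¬ 3 ∣ NumberField.classNumber ↥(fixedField (Subgroup.zpowers (absRestrictNormalHom (W.divisionField 3) c))))
    (hv : haveI : NumberField ↥(W.divisionField 3) := NumberField.mk
      ∃! v : IsDedekindDomain.HeightOneSpectrum (𝓞 ↥(fixedField (Subgroup.zpowers (absRestrictNormalHom (W.divisionField 3) c)))),
        ((3 : ℕ) : 𝓞 ↥(fixedField (Subgroup.zpowers (absRestrictNormalHom (W.divisionField 3) c)))) ∈ v.asIdeal)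
    (hqrk : haveI : NumberField ↥(W.divisionField 3) := NumberField.mk
      ∀ K : IntermediateField ℚ ↥(W.divisionField 3), Module.finrank ℚ ↥K = 2 →
        ¬ K ≤ fixedField (Subgroup.zpowers (absRestrictNormalHom (W.divisionField 3) c)) →
        ∀ κE : ZpExtension ↥K 3, κE.IsCyclotomic → classGroupPRank κE (0 + 1) = classGroupPRank κE 0) :
    MissingUpperBoundAt W 3 := by
  subst hWeq
  exact CartanMuRoadQuadraticDoors.missingUpperBoundAt_three_wild_of_hasModPImageEqNonsplitCartanNormalizer_of_realClassNumber_of_quadRankSuccEqAt _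
    hKatoA hGZK hmod hr classO6_g19008bu1_3 irr_g19008bu1_3 hasModPImageEqNonsplitCartanNormalizer_g19008bu1_3 hc hh hv 0 hqrk

/-- **(A) at `(19872ba1, 3)` from `3 ∤ h(ℚ(P)) and one prime of ℚ(P) above 3 (Iwasawa 1956)` and `rank₃ Cl(K₁) = rank₃ Cl(K₀)` on the two imaginary quadratic subfields — NO NAMED FACT** (Coates–Sujatha 3.4,
Iwasawa 1956, Fukuda Thm. 1 PROVED; Ferrero–Washington REMOVED; door `CartanMuRoadQuadraticDoors`; kernel certificates `irr_g19872ba1_3`, `hasModPImageEqNonsplitCartanNormalizer_g19872ba1_3` reused).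
DISPLAYED: quadratic subfields of `ℚ(E[3])` (kit j326955): `ℚ(√−3)`, `ℚ(√-4)`, `ℚ(√12)` (real); the imaginary pair certified for `hqrk`: `ℚ(√-3)`: `h = 1` (`Cl ≅ []`), layer 1 `K₁ = ℚ(√-3)·ℚ(ζ₉)⁺` = `x^6 - x^3 + 1`, `h(K₁) = 1` (`Cl ≅ []`), `rank₃`: `0 = 0` — bnfcertify 1/1; `ℚ(√-4)`: `h = 1` (`Cl ≅ []`), layer 1 `K₁ = ℚ(√-4)·ℚ(ζ₉)⁺` = `x^6 + 6*x^4 + 9*x^2 + 1`, `h(K₁) = 1` (`Cl ≅ []`), `rank₃`: `0 = 0` — bnfcertify 1/1. Per row; (A) is now a consequence of displayed integers ALONE.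
[cite: Fukuda1994, Thm. 1, p. 264] [cite: CoatesSujatha2005, Thm. 3.4 (§3)] [cite: Washington1997, §13.1, §13.3 Prop. 13.23] [cite: Cremona2006, Table 1 (Cremona label 19872ba1)] -/
theorem conjA_g19872ba1_3_iw_quad
    {W : WeierstrassCurve ℚ} [W.IsElliptic] (hWeq : W = (⟨0, 0, 0, (-127116), (-17444160)⟩ : WeierstrassCurve ℚ))
    {c : absoluteGaloisGroup ℚ} (hc : IsComplexConjugation (Rat.castHom ℝ) c)
    (hh : haveI : NumberField ↥(W.divisionField 3) := NumberField.mk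
      ¬ 3 ∣ NumberField.classNumber ↥(fixedField (Subgroup.zpowers (absRestrictNormalHom (W.divisionField 3) c))))
    (hv : haveI : NumberField ↥(W.divisionField 3) := NumberField.mk
      ∃! v : IsDedekindDomain.HeightOneSpectrum (𝓞 ↥(fixedField (Subgroup.zpowers (absRestrictNormalHom (W.divisionField 3) c)))),
        ((3 : ℕ) : 𝓞 ↥(fixedField (Subgroup.zpowers (absRestrictNormalHom (W.divisionField 3) c)))) ∈ v.asIdeal)
    (hqrk : haveI : NumberField ↥(W.divisionField 3) := NumberField.mk
      ∀ K : IntermediateField ℚ ↥(W.divisionField 3), Module.finrank ℚ ↥K = 2 →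
        ¬ K ≤ fixedField (Subgroup.zpowers (absRestrictNormalHom (W.divisionField 3) c)) →
        ∀ κE : ZpExtension ↥K 3, κE.IsCyclotomic → classGroupPRank κE (0 + 1) = classGroupPRank κE 0)
    (κ : ZpExtension ℚ 3) (hκ : κ.IsCyclotomic) :
    ∃ (γ : absoluteGaloisGroup ℚ) (Df : W.FineSelmerDualData κ γ),
      Module.Finite ℤ_[3] (RestrictScalars ℤ_[3] (IwasawaAlgebra 3) Df.X) := by
  subst hWeq
  exact CartanMuRoadQuadraticDoors.conjA_three_of_hasModPImageEqNonsplitCartanNormalizer_of_realClassNumber_of_quadRankSuccEqAt _ irr_g19872ba1_3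
    hasModPImageEqNonsplitCartanNormalizer_g19872ba1_3 hc hh hv 0 hqrk κ hκ

/-- **RECORD — UPPER half `ord₃ #Ш(E) ≤ ord₃ #Ш(E)_an` for `E = 19872ba1` at `p = 3` (O6 wild) from `3 ∤ h(ℚ(P)) and one prime of ℚ(P) above 3 (Iwasawa 1956)` and the imaginary-quadratic rank datum `hqrk`, modulo `hKatoA hGZK hmod` ONLY**
(Ferrero–Washington REMOVED; kernel certificates `classO6_…`, `irr_…`, `hasModPImageEqNonsplitCartanNormalizer_…` reused; Cremona's `r_an = 0` displayed).
DISPLAYED: quadratic subfields of `ℚ(E[3])` (kit j326955): `ℚ(√−3)`, `ℚ(√-4)`, `ℚ(√12)` (real); the imaginary pair certified for `hqrk`: `ℚ(√-3)`: `h = 1` (`Cl ≅ []`), layer 1 `K₁ = ℚ(√-3)·ℚ(ζ₉)⁺` = `x^6 - x^3 + 1`, `h(K₁) = 1` (`Cl ≅ []`), `rank₃`: `0 = 0` — bnfcertify 1/1; `ℚ(√-4)`: `h = 1` (`Cl ≅ []`), layer 1 `K₁ = ℚ(√-4)·ℚ(ζ₉)⁺` = `x^6 + 6*x^4 + 9*x^2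 + 1`, `h(K₁) = 1` (`Cl ≅ []`), `rank₃`: `0 = 0` — bnfcertify 1/1. Per row; nothing booked; BSD is not proved by this. [cite: Kato2004Asterisque, Thm. 14.5 (3) (p. 236)] [cite: Fukuda1994, Thm. 1, p. 264]
[cite: CoatesSujatha2005, Thm. 3.4 (§3)] [cite: Cremona2006, Table 1 (Cremona label 19872ba1)] -/
theorem missingUpperBoundAt_g19872ba1_3_iw_quad
    (hKatoA : Kato2004.rankZero_padicValNat_sha_add_padicValNat_tamagawa_le_of_additive_potGood_of_irreducible_of_fineSelmerDual_fg)
    (hGZK : rank_eq_analyticRank_of_analyticRank_le_one) (hmod : hasEntireLFunction_rat)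
    {W : WeierstrassCurve ℚ} [W.IsElliptic] [W.IsGloballyMinimal] (hWeq : W = (⟨0, 0, 0, (-127116), (-17444160)⟩ : WeierstrassCurve ℚ)) (hr : W.analyticRank = 0)
    {c : absoluteGaloisGroup ℚ} (hc : IsComplexConjugation (Rat.castHom ℝ) c)
    (hh : haveI : NumberField ↥(W.divisionField 3) := NumberField.mk
      ¬ 3 ∣ NumberField.classNumber ↥(fixedField (Subgroup.zpowers (absRestrictNormalHom (W.divisionField 3) c))))
    (hv : haveI : NumberField ↥(W.divisionField 3) := NumberField.mk
      ∃! v : IsDedekindDomain.HeightOneSpectrum (𝓞 ↥(fixedField (Subgroup.zpowers (absRestrictNormalHom (W.divisionField 3) c)))),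
        ((3 : ℕ) : 𝓞 ↥(fixedField (Subgroup.zpowers (absRestrictNormalHom (W.divisionField 3) c)))) ∈ v.asIdeal)
    (hqrk : haveI : NumberField ↥(W.divisionField 3) := NumberField.mk
      ∀ K : IntermediateField ℚ ↥(W.divisionField 3), Module.finrank ℚ ↥K = 2 →
        ¬ K ≤ fixedField (Subgroup.zpowers (absRestrictNormalHom (W.divisionField 3) c)) →
        ∀ κE : ZpExtension ↥K 3, κE.IsCyclotomic → classGroupPRank κE (0 + 1) = classGroupPRank κE 0) :
    MissingUpperBoundAt W 3 := by
  subst hWeq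
  exact CartanMuRoadQuadraticDoors.missingUpperBoundAt_three_wild_of_hasModPImageEqNonsplitCartanNormalizer_of_realClassNumber_of_quadRankSuccEqAt _
    hKatoA hGZK hmod hr classO6_g19872ba1_3 irr_g19872ba1_3 hasModPImageEqNonsplitCartanNormalizer_g19872ba1_3 hc hh hv 0 hqrk

/-- **(A) at `(112455bk1, 3)` from `3 ∤ h(ℚ(P)) and one prime of ℚ(P) above 3 (Iwasawa 1956)` and `rank₃ Cl(K₁) = rank₃ Cl(K₀)` on the two imaginary quadratic subfields — NO NAMED FACT** (Coates–Sujatha 3.4,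
Iwasawa 1956, Fukuda Thm. 1 PROVED; Ferrero–Washington REMOVED; door `CartanMuRoadQuadraticDoors`; kernel certificates `irr_g112455bk1_3`, `hasModPImageEqNonsplitCartanNormalizer_g112455bk1_3` reused).
DISPLAYED: quadratic subfields of `ℚ(E[3])` (kit j326955): `ℚ(√−3)`, `ℚ(√-7)`, `ℚ(√21)` (real); the imaginary pair certified for `hqrk`: `ℚ(√-3)`: `h = 1` (`Cl ≅ []`), layer 1 `K₁ = ℚ(√-3)·ℚ(ζ₉)⁺` = `x^6 - x^3 + 1`, `h(K₁) = 1` (`Cl ≅ []`), `rank₃`: `0 = 0` — bnfcertify 1/1; `ℚ(√-7)`: `h = 1` (`Cl ≅ []`), layer 1 `K₁ = ℚ(√-7)·ℚ(ζ₉)⁺` = `x^6 + 9*x^4 - 5*x^3 + 36*x^2 - 12*x + 8`, `h(K₁) = 1` (`Cl ≅ []`), `rank₃`: `0 = 0` — bnfcertify 1/1. Per row; (A) is now a consequence of displayed integers ALONE.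
[cite: Fukuda1994, Thm. 1, p. 264] [cite: CoatesSujatha2005, Thm. 3.4 (§3)] [cite: Washington1997, §13.1, §13.3 Prop. 13.23] [cite: Cremona2006, Table 1 (Cremona label 112455bk1)] -/
theorem conjA_g112455bk1_3_iw_quad
    {W : WeierstrassCurve ℚ} [W.IsElliptic] (hWeq : W = (⟨1, (-1), 0, (-12324300), 16726248125⟩ : WeierstrassCurve ℚ))
    {c : absoluteGaloisGroup ℚ} (hc : IsComplexConjugation (Rat.castHom ℝ) c)
    (hh : haveI : NumberField ↥(W.divisionField 3) := NumberField.mk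
      ¬ 3 ∣ NumberField.classNumber ↥(fixedField (Subgroup.zpowers (absRestrictNormalHom (W.divisionField 3) c))))
    (hv : haveI : NumberField ↥(W.divisionField 3) := NumberField.mk
      ∃! v : IsDedekindDomain.HeightOneSpectrum (𝓞 ↥(fixedField (Subgroup.zpowers (absRestrictNormalHom (W.divisionField 3) c)))),
        ((3 : ℕ) : 𝓞 ↥(fixedField (Subgroup.zpowers (absRestrictNormalHom (W.divisionField 3) c)))) ∈ v.asIdeal)
    (hqrk : haveI : NumberField ↥(W.divisionField 3) := NumberField.mk
      ∀ K : IntermediateField ℚ ↥(W.divisionField 3), Module.finrank ℚ ↥K = 2 →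
        ¬ K ≤ fixedField (Subgroup.zpowers (absRestrictNormalHom (W.divisionField 3) c)) →
        ∀ κE : ZpExtension ↥K 3, κE.IsCyclotomic → classGroupPRank κE (0 + 1) = classGroupPRank κE 0)
    (κ : ZpExtension ℚ 3) (hκ : κ.IsCyclotomic) :
    ∃ (γ : absoluteGaloisGroup ℚ) (Df : W.FineSelmerDualData κ γ),
      Module.Finite ℤ_[3] (RestrictScalars ℤ_[3] (IwasawaAlgebra 3) Df.X) := by
  subst hWeq
  exact CartanMuRoadQuadraticDoors.conjA_three_of_hasModPImageEqNonsplitCartanNormalizer_of_realClassNumber_of_quadRankSuccEqAt _ irr_g112455bk1_3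
    hasModPImageEqNonsplitCartanNormalizer_g112455bk1_3 hc hh hv 0 hqrk κ hκ

/-- **RECORD — UPPER half `ord₃ #Ш(E) ≤ ord₃ #Ш(E)_an` for `E = 112455bk1` at `p = 3` (O6 wild) from `3 ∤ h(ℚ(P)) and one prime of ℚ(P) above 3 (Iwasawa 1956)` and the imaginary-quadratic rank datum `hqrk`, modulo `hKatoA hGZK hmod` ONLY**
(Ferrero–Washington REMOVED; kernel certificates `classO6_…`, `irr_…`, `hasModPImageEqNonsplitCartanNormalizer_…` reused; Cremona's `r_an = 0` displayed).
DISPLAYED: quadratic subfields of `ℚ(E[3])` (kit j326955): `ℚ(√−3)`, `ℚ(√-7)`, `ℚ(√21)` (real); the imaginary pair certified for `hqrk`: `ℚ(√-3)`: `h = 1` (`Cl ≅ []`), layer 1 `K₁ = ℚ(√-3)·ℚ(ζ₉)⁺` = `x^6 - x^3 + 1`, `h(K₁) = 1` (`Cl ≅ []`), `rank₃`: `0 = 0` — bnfcertify 1/1; `ℚ(√-7)`: `h = 1` (`Cl ≅ []`), layer 1 `K₁ = ℚ(√-7)·ℚ(ζ₉)⁺` = `x^6 + 9*x^4 - 5*x^3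 + 36*x^2 - 12*x + 8`, `h(K₁) = 1` (`Cl ≅ []`), `rank₃`: `0 = 0` — bnfcertify 1/1. Per row; nothing booked; BSD is not proved by this. [cite: Kato2004Asterisque, Thm. 14.5 (3) (p. 236)] [cite: Fukuda1994, Thm. 1, p. 264]
[cite: CoatesSujatha2005, Thm. 3.4 (§3)] [cite: Cremona2006, Table 1 (Cremona label 112455bk1)] -/
theorem missingUpperBoundAt_g112455bk1_3_iw_quad
    (hKatoA : Kato2004.rankZero_padicValNat_sha_add_padicValNat_tamagawa_le_of_additive_potGood_of_irreducible_of_fineSelmerDual_fg)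
    (hGZK : rank_eq_analyticRank_of_analyticRank_le_one) (hmod : hasEntireLFunction_rat)
    {W : WeierstrassCurve ℚ} [W.IsElliptic] [W.IsGloballyMinimal] (hWeq : W = (⟨1, (-1), 0, (-12324300), 16726248125⟩ : WeierstrassCurve ℚ)) (hr : W.analyticRank = 0)
    {c : absoluteGaloisGroup ℚ} (hc : IsComplexConjugation (Rat.castHom ℝ) c)
    (hh : haveI : NumberField ↥(W.divisionField 3) := NumberField.mk
      ¬ 3 ∣ NumberField.classNumber ↥(fixedField (Subgroup.zpowers (absRestrictNormalHom (W.divisionField 3) c))))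
    (hv : haveI : NumberField ↥(W.divisionField 3) := NumberField.mk
      ∃! v : IsDedekindDomain.HeightOneSpectrum (𝓞 ↥(fixedField (Subgroup.zpowers (absRestrictNormalHom (W.divisionField 3) c)))),
        ((3 : ℕ) : 𝓞 ↥(fixedField (Subgroup.zpowers (absRestrictNormalHom (W.divisionField 3) c)))) ∈ v.asIdeal)
    (hqrk : haveI : NumberField ↥(W.divisionField 3) := NumberField.mk
      ∀ K : IntermediateField ℚ ↥(W.divisionField 3), Module.finrank ℚ ↥K = 2 →
        ¬ K ≤ fixedField (Subgroup.zpowers (absRestrictNormalHom (W.divisionField 3) c)) →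
        ∀ κE : ZpExtension ↥K 3, κE.IsCyclotomic → classGroupPRank κE (0 + 1) = classGroupPRank κE 0) :
    MissingUpperBoundAt W 3 := by
  subst hWeq
  exact CartanMuRoadQuadraticDoors.missingUpperBoundAt_three_wild_of_hasModPImageEqNonsplitCartanNormalizer_of_realClassNumber_of_quadRankSuccEqAt _
    hKatoA hGZK hmod hr classO6_g112455bk1_3 irr_g112455bk1_3 hasModPImageEqNonsplitCartanNormalizer_g112455bk1_3 hc hh hv 0 hqrk

/-- **(A) at `(117747bf1, 3)` from `3 ∤ h(ℚ(P)) and one prime of ℚ(P) above 3 (Iwasawa 1956)` and `rank₃ Cl(K₁) = rank₃ Cl(K₀)` on the two imaginary quadratic subfields — NO NAMED FACT** (Coates–Sujatha 3.4,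
Iwasawa 1956, Fukuda Thm. 1 PROVED; Ferrero–Washington REMOVED; door `CartanMuRoadQuadraticDoors`; kernel certificates `irr_g117747bf1_3`, `hasModPImageEqNonsplitCartanNormalizer_g117747bf1_3` reused).
DISPLAYED: quadratic subfields of `ℚ(E[3])` (kit j326955): `ℚ(√−3)`, `ℚ(√-7)`, `ℚ(√21)` (real); the imaginary pair certified for `hqrk`: `ℚ(√-3)`: `h = 1` (`Cl ≅ []`), layer 1 `K₁ = ℚ(√-3)·ℚ(ζ₉)⁺` = `x^6 - x^3 + 1`, `h(K₁) = 1` (`Cl ≅ []`), `rank₃`: `0 = 0` — bnfcertify 1/1; `ℚ(√-7)`: `h = 1` (`Cl ≅ []`), layer 1 `K₁ = ℚ(√-7)·ℚ(ζ₉)⁺` = `x^6 + 9*x^4 - 5*x^3 + 36*x^2 - 12*x + 8`, `h(K₁) = 1` (`Cl ≅ []`), `rank₃`: `0 = 0` — bnfcertify 1/1. Per row; (A) is now a consequence of displayed integers ALONE.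
[cite: Fukuda1994, Thm. 1, p. 264] [cite: CoatesSujatha2005, Thm. 3.4 (§3)] [cite: Washington1997, §13.1, §13.3 Prop. 13.23] [cite: Cremona2006, Table 1 (Cremona label 117747bf1)] -/
theorem conjA_g117747bf1_3_iw_quad
    {W : WeierstrassCurve ℚ} [W.IsElliptic] (hWeq : W = (⟨0, 0, 1, (-3334802751), 74123053896764⟩ : WeierstrassCurve ℚ))
    {c : absoluteGaloisGroup ℚ} (hc : IsComplexConjugation (Rat.castHom ℝ) c)
    (hh : haveI : NumberField ↥(W.divisionField 3) := NumberField.mk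
      ¬ 3 ∣ NumberField.classNumber ↥(fixedField (Subgroup.zpowers (absRestrictNormalHom (W.divisionField 3) c))))
    (hv : haveI : NumberField ↥(W.divisionField 3) := NumberField.mk
      ∃! v : IsDedekindDomain.HeightOneSpectrum (𝓞 ↥(fixedField (Subgroup.zpowers (absRestrictNormalHom (W.divisionField 3) c)))),
        ((3 : ℕ) : 𝓞 ↥(fixedField (Subgroup.zpowers (absRestrictNormalHom (W.divisionField 3) c)))) ∈ v.asIdeal)
    (hqrk : haveI : NumberField ↥(W.divisionField 3) := NumberField.mk
      ∀ K : IntermediateField ℚ ↥(W.divisionField 3), Module.finrank ℚ ↥K = 2 →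
        ¬ K ≤ fixedField (Subgroup.zpowers (absRestrictNormalHom (W.divisionField 3) c)) →
        ∀ κE : ZpExtension ↥K 3, κE.IsCyclotomic → classGroupPRank κE (0 + 1) = classGroupPRank κE 0)
    (κ : ZpExtension ℚ 3) (hκ : κ.IsCyclotomic) :
    ∃ (γ : absoluteGaloisGroup ℚ) (Df : W.FineSelmerDualData κ γ),
      Module.Finite ℤ_[3] (RestrictScalars ℤ_[3] (IwasawaAlgebra 3) Df.X) := by
  subst hWeq
  exact CartanMuRoadQuadraticDoors.conjA_three_of_hasModPImageEqNonsplitCartanNormalizer_of_realClassNumber_of_quadRankSuccEqAt _ irr_g117747bf1_3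
    hasModPImageEqNonsplitCartanNormalizer_g117747bf1_3 hc hh hv 0 hqrk κ hκ

/-- **RECORD — UPPER half `ord₃ #Ш(E) ≤ ord₃ #Ш(E)_an` for `E = 117747bf1` at `p = 3` (O6 wild) from `3 ∤ h(ℚ(P)) and one prime of ℚ(P) above 3 (Iwasawa 1956)` and the imaginary-quadratic rank datum `hqrk`, modulo `hKatoA hGZK hmod` ONLY**
(Ferrero–Washington REMOVED; kernel certificates `classO6_…`, `irr_…`, `hasModPImageEqNonsplitCartanNormalizer_…` reused; Cremona's `r_an = 0` displayed).
DISPLAYED: quadratic subfields of `ℚ(E[3])` (kit j326955): `ℚ(√−3)`, `ℚ(√-7)`, `ℚ(√21)` (real); the imaginary pair certified for `hqrk`: `ℚ(√-3)`: `h = 1` (`Cl ≅ []`), layer 1 `K₁ = ℚ(√-3)·ℚ(ζ₉)⁺` = `x^6 - x^3 + 1`, `h(K₁) = 1` (`Cl ≅ []`), `rank₃`: `0 = 0` — bnfcertify 1/1; `ℚ(√-7)`: `h = 1` (`Cl ≅ []`), layer 1 `K₁ = ℚ(√-7)·ℚ(ζ₉)⁺` = `x^6 + 9*x^4 - 5*x^3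 + 36*x^2 - 12*x + 8`, `h(K₁) = 1` (`Cl ≅ []`), `rank₃`: `0 = 0` — bnfcertify 1/1. Per row; nothing booked; BSD is not proved by this. [cite: Kato2004Asterisque, Thm. 14.5 (3) (p. 236)] [cite: Fukuda1994, Thm. 1, p. 264]
[cite: CoatesSujatha2005, Thm. 3.4 (§3)] [cite: Cremona2006, Table 1 (Cremona label 117747bf1)] -/
theorem missingUpperBoundAt_g117747bf1_3_iw_quad
    (hKatoA : Kato2004.rankZero_padicValNat_sha_add_padicValNat_tamagawa_le_of_additive_potGood_of_irreducible_of_fineSelmerDual_fg)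
    (hGZK : rank_eq_analyticRank_of_analyticRank_le_one) (hmod : hasEntireLFunction_rat)
    {W : WeierstrassCurve ℚ} [W.IsElliptic] [W.IsGloballyMinimal] (hWeq : W = (⟨0, 0, 1, (-3334802751), 74123053896764⟩ : WeierstrassCurve ℚ)) (hr : W.analyticRank = 0)
    {c : absoluteGaloisGroup ℚ} (hc : IsComplexConjugation (Rat.castHom ℝ) c)
    (hh : haveI : NumberField ↥(W.divisionField 3) := NumberField.mk
      ¬ 3 ∣ NumberField.classNumber ↥(fixedField (Subgroup.zpowers (absRestrictNormalHom (W.divisionField 3) c))))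
    (hv : haveI : NumberField ↥(W.divisionField 3) := NumberField.mk
      ∃! v : IsDedekindDomain.HeightOneSpectrum (𝓞 ↥(fixedField (Subgroup.zpowers (absRestrictNormalHom (W.divisionField 3) c)))),
        ((3 : ℕ) : 𝓞 ↥(fixedField (Subgroup.zpowers (absRestrictNormalHom (W.divisionField 3) c)))) ∈ v.asIdeal)
    (hqrk : haveI : NumberField ↥(W.divisionField 3) := NumberField.mk
      ∀ K : IntermediateField ℚ ↥(W.divisionField 3), Module.finrank ℚ ↥K = 2 →
        ¬ K ≤ fixedField (Subgroup.zpowers (absRestrictNormalHom (W.divisionField 3) c)) →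
        ∀ κE : ZpExtension ↥K 3, κE.IsCyclotomic → classGroupPRank κE (0 + 1) = classGroupPRank κE 0) :
    MissingUpperBoundAt W 3 := by
  subst hWeq
  exact CartanMuRoadQuadraticDoors.missingUpperBoundAt_three_wild_of_hasModPImageEqNonsplitCartanNormalizer_of_realClassNumber_of_quadRankSuccEqAt _
    hKatoA hGZK hmod hr classO6_g117747bf1_3 irr_g117747bf1_3 hasModPImageEqNonsplitCartanNormalizer_g117747bf1_3 hc hh hv 0 hqrk

end Summit.BirchSwinnertonDyer.BirchSwinnertonDyer.Theorems.WildUpperUnitTwistRecords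

end
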